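import Summits.ResolutionOfSingularities.ResolutionOfSingularities.Theorems.FrobeniusLadderFInjectiveMacaulayficationLocalFullificationFibreAdmGe4Split
import Mathlib.RingTheory.KrullDimension.Field
import HarnessLib

/-!
# (CZ2-B) THE CM-HALF OF THE ADMISSIBLE LOCAL DOOR FROM THE SUPPORTED READING (B) OF ČESNAVIČIUS'S BLOW-UP MACAULAYFICATION
# (crux `FInjectiveMacaulayfication` stmt-ResolutionOfSingularities-15315, chain w45a; programme «CZ»; variant (B) of the fact text = res-L1-w45a-tri-2's
# «W-supported» reading of [Česnavičius 2021, Thm. 5.3], rendered by this seat as `CesnaviciusBlowupMacaulayficationOffClosed`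
# (HOME `L/res-L1-w45a-stub-2/MacaulayficationBlowupFormSupported.lean`, sha16 4b38abcc4649efc5); seat res-L1-w45a-stub-2 g6)

[OURS · L1 W4.5a] Support file (`--supports stmt-ResolutionOfSingularities-15315 --as helper`); replaces the role of NO printed item; NOT a statement of
the manuscript; def-free; THEOREMS modulo ONE printed result taken as the HYPOTHESIS `hM`, spelled out token for token as text (B): *for `Y` integral
Noetherian excellent and a CLOSED `W ⊆ Y` off which every stalk is Cohen–Macaulay, there is an ideal sheaf `Z` with `Supp Z ⊆ W` all of whose
blowings up have Cohen–Macaulay stalks* (Thm. 5.3's centre is disjoint from `CM(Y) ⊇ Y ∖ W`). Companion of `LocalMacaulayficationOfFact` (p589894,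
variant (A) = Thm. 5.3's own form): whichever text the desk admits, the door's CM-half follows by unfolding. AI-written (AI review is weaker than
expert review).

THE REDUCTION `exists_cmCentre_of_factOffClosed`: for `x` with `dim 𝒪_{X,x} = d ≠ 0` and `g : S′ → Spec 𝒪_{X,x}` a blowing up along `I ≠ ⊥` regular
off its closed fibre, apply (B) to the excellent integral `S′` (`LocalMacaulayficationOfFact.isExcellent_Spec_stalk_of_field`, `IsBlowup.isExcellent`)
with `W :=` the CLOSED FIBRE `g⁻¹(closed point)` (closed; off `W` the stalks are regular hence CM): the centre `Z` is fibre-supported BY THE FACT;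
`Z ≠ ⊥` because `S′` has a point OFF the fibre — the blow-up is an isomorphism over the generic point of `Spec 𝒪_{X,x}` (not in `Supp I` as `I ≠ ⊥`),
which differs from the closed point since `𝒪_{X,x}` is not a field (`d ≠ 0`). Every blowing up along `Z` is integral (domain stalks) with CM stalks.
* `localMacaulayficationFibreAdmGe4_of_factOffClosed (hM)` — (LF_adm-CM) from (B) (uses `d ≥ 4 > 0`);
* `localFullificationFibreAdmGe4_of_factOffClosed_of_F (hM) (hF : LocalFInjectivizationFibreAdmGe4)` — door v37's shape under text (B).
[folklore assembly; cite: Cesnavicius2021, Thm. 5.3 and Ex. 1.3] [cite: Matsumura1987, §32 p. 260]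
-/

-- single-problem summit: the doubled namespace component is forced
set_option linter.dupNamespace false

noncomputable section

namespace Summit.ResolutionOfSingularities.ResolutionOfSingularities.Theorems.FInjectiveMacaulayfication.LocalMacaulayficationOfFactOffClosed

open CategoryTheory CategoryTheory.Limits AlgebraicGeometry TopologicalSpace IsLocalRing
open Literature.AlgebraicGeometry.Resolution
open Summit.ResolutionOfSingularities.ResolutionOfSingularities.Theorems.FInjectiveMacaulayfication
open SliceableCentre

/-! ## §1 A point off the closed fibre -/

/-- The generic point of the spectrum of a local domain that is not a field (Krull dimension `≠ 0`) is not the closed point. [folklore] -/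
theorem genericPoint_ne_closedPoint_of_ringKrullDim_ne_zero (A : Type) [CommRing A] [IsDomain A] [IsLocalRing A]
    (hdim : ringKrullDim A ≠ 0) : genericPoint (Spec (.of A)) ≠ IsLocalRing.closedPoint A := by
  intro h
  have h1 : (⊥ : Ideal A) = maximalIdeal A := by
    have h2 := congrArg PrimeSpectrum.asIdeal h
    rw [genericPoint_eq_bot_of_affine] at h2
    exact h2
  exact hdim (ringKrullDim_eq_zero_of_isField (IsLocalRing.isField_iff_maximalIdeal_eq.mpr h1.symm))

/-! ## §2 The reduction -/

/-- **The CM-centre from the supported reading (B) of Česnavičius's blow-up Macaulayfication** (see the module docstring).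
[OURS · conditional on the fact text (B)] [cite: Cesnavicius2021, Thm. 5.3] -/
theorem exists_cmCentre_of_factOffClosed
    (hM : ∀ (Y : Scheme.{0}) [IsIntegral Y] [IsNoetherian Y], Scheme.IsExcellent Y →
      ∀ W : Set Y, IsClosed W →
        (∀ y : Y, y ∉ W → ∀ d : ℕ, ringKrullDim (Y.presheaf.stalk y) = d →
            ∀ s : Fin d → Y.presheaf.stalk y, (Ideal.span (Set.range s)).radical.IsMaximal →
              RingTheory.Sequence.IsWeaklyRegular (Y.presheaf.stalk y) (List.ofFn s)) →
        ∃ Z : Y.IdealSheafData, (Z.support : Set Y) ⊆ W ∧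
          ∀ (Y' : Scheme.{0}) (π : Y' ⟶ Y), IsBlowup π Z →
            ∀ y' : Y', ∀ d : ℕ, ringKrullDim (Y'.presheaf.stalk y') = d →
              ∀ s : Fin d → Y'.presheaf.stalk y', (Ideal.span (Set.range s)).radical.IsMaximal →
                RingTheory.Sequence.IsWeaklyRegular (Y'.presheaf.stalk y') (List.ofFn s))
    (p : ℕ) (hp : p.Prime) {k : Type} [Field k] [CharP k p] {X : Scheme.{0}} (f : X ⟶ Spec (.of k))
    [LocallyOfFiniteType f] [IsIntegral X] (x : X) (hx : ringKrullDim (X.presheaf.stalk x) ≠ 0)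
    (S' : Scheme.{0}) (g : S' ⟶ Spec (X.presheaf.stalk x)) (I : (Spec (X.presheaf.stalk x)).IdealSheafData)
    (hI : I ≠ ⊥) (hg : IsBlowup g I)
    (hreg : ∀ s : S', g.base s ≠ closedPoint (X.presheaf.stalk x) → s ∈ Scheme.regularLocus S') :
    ∃ 𝓚 : S'.IdealSheafData, 𝓚 ≠ ⊥ ∧ (∀ s ∈ (𝓚.support : Set S'), g.base s = closedPoint (X.presheaf.stalk x)) ∧
      ∀ (S'' : Scheme.{0}) (π : S'' ⟶ S'), IsBlowup π 𝓚 → ∀ s : S'', IsDomain (S''.presheaf.stalk s) ∧ CMCl (S''.presheaf.stalk s) := by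
  haveI : Fact p.Prime := ⟨hp⟩
  haveI : IsLocallyNoetherian X := LocallyOfFiniteType.isLocallyNoetherian f
  haveI : IsIntegral S' := hg.isIntegral hI
  haveI : IsProper g := hg.isProper
  haveI : IsLocallyNoetherian S' := LocallyOfFiniteType.isLocallyNoetherian g
  haveI : CompactSpace S' := QuasiCompact.compactSpace_of_compactSpace g
  haveI : IsNoetherian S' := {}
  have hS'exc : Scheme.IsExcellent S' := hg.isExcellent (LocalMacaulayficationOfFact.isExcellent_Spec_stalk_of_field f x)
  -- `W :=` the closed fibre: closed, and `S'` is regular, hence Cohen–Macaulay, off it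
  have hWcl : IsClosed {s : S' | g.base s = closedPoint (X.presheaf.stalk x)} :=
    (IsLocalRing.isClosed_singleton_closedPoint (X.presheaf.stalk x)).preimage g.base.hom.continuous
  have hWcm : ∀ s : S', s ∉ {s : S' | g.base s = closedPoint (X.presheaf.stalk x)} → CMCl (S'.presheaf.stalk s) := fun s hs => by
    have hs' := hreg s hs
    rw [Scheme.mem_regularLocus] at hs'
    haveI := hs'
    haveI : CharP (S'.presheaf.stalk s) p := FTemkinClosedPoints.charP_stalk_of_over p f (g ≫ X.fromSpecStalk x) s
    exact LocalMacaulayficationOfFact.cmCl_of_isRegularLocalRing p _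
  obtain ⟨Z, hZW, hZbl⟩ := hM S' hS'exc {s : S' | g.base s = closedPoint (X.presheaf.stalk x)} hWcl hWcm
  -- `Z ≠ ⊥`: `S'` has a point off the closed fibre (over the generic point of `Spec 𝒪_{X,x}`, where `g` is an isomorphism)
  have hZne : Z ≠ ⊥ := by
    intro h0
    have hη : genericPoint (Spec (X.presheaf.stalk x)) ∉ (I.support : Set _) := not_mem_support_genericPoint hI
    obtain ⟨s, hs⟩ := RegularBlowupModelDim2.exists_preimage_of_isBlowup_of_not_mem hg _ hη
    have hsW : g.base s = closedPoint (X.presheaf.stalk x) := hZW (by rw [h0, Scheme.IdealSheafData.support_bot]; trivial)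
    exact genericPoint_ne_closedPoint_of_ringKrullDim_ne_zero (X.presheaf.stalk x) hx (hs.symm.trans hsW)
  refine ⟨Z, hZne, fun s hs => hZW hs, fun S'' π hπ s => ?_⟩
  haveI : IsIntegral S'' := hπ.isIntegral hZne
  exact ⟨inferInstance, hZbl S'' π hπ s⟩

/-! ## §3 The CM-half of the registered stub, and door v37's shape, under text (B) -/

/-- **(LF_adm-CM) ⟸ [Česnavičius 2021, Thm. 5.3, supported reading (B)].** [OURS · conditional on the fact text (B)] [cite: Cesnavicius2021, Thm. 5.3] -/
theorem localMacaulayficationFibreAdmGe4_of_factOffClosed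
    (hM : ∀ (Y : Scheme.{0}) [IsIntegral Y] [IsNoetherian Y], Scheme.IsExcellent Y →
      ∀ W : Set Y, IsClosed W →
        (∀ y : Y, y ∉ W → ∀ d : ℕ, ringKrullDim (Y.presheaf.stalk y) = d →
            ∀ s : Fin d → Y.presheaf.stalk y, (Ideal.span (Set.range s)).radical.IsMaximal →
              RingTheory.Sequence.IsWeaklyRegular (Y.presheaf.stalk y) (List.ofFn s)) →
        ∃ Z : Y.IdealSheafData, (Z.support : Set Y) ⊆ W ∧
          ∀ (Y' : Scheme.{0}) (π : Y' ⟶ Y), IsBlowup π Z →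
            ∀ y' : Y', ∀ d : ℕ, ringKrullDim (Y'.presheaf.stalk y') = d →
              ∀ s : Fin d → Y'.presheaf.stalk y', (Ideal.span (Set.range s)).radical.IsMaximal →
                RingTheory.Sequence.IsWeaklyRegular (Y'.presheaf.stalk y') (List.ofFn s))
    : LocalFullificationFibreAdmGe4Split.LocalMacaulayficationFibreAdmGe4 := by
  intro d hd p hp k _ _ X f _ hft _ hint x _ _ hx S' g I hI _ hg hreg
  haveI := hft
  have hx0 : ringKrullDim (X.presheaf.stalk x) ≠ 0 := by
    rw [hx]; exact_mod_cast (by omega : d ≠ 0)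
  exact exists_cmCentre_of_factOffClosed hM p hp f x hx0 S' g I hI hg hreg

/-- **(LF_adm) ⟸ [Česnavičius 2021, Thm. 5.3, reading (B)] ∧ (LF_adm-F)** — door v37's shape under text (B).
[OURS · conditional on the fact text (B) and on the CANDIDATE F-half] [cite: Cesnavicius2021, Thm. 5.3] -/
theorem localFullificationFibreAdmGe4_of_factOffClosed_of_F
    (hM : ∀ (Y : Scheme.{0}) [IsIntegral Y] [IsNoetherian Y], Scheme.IsExcellent Y →
      ∀ W : Set Y, IsClosed W →
        (∀ y : Y, y ∉ W → ∀ d : ℕ, ringKrullDim (Y.presheaf.stalk y) = d →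
            ∀ s : Fin d → Y.presheaf.stalk y, (Ideal.span (Set.range s)).radical.IsMaximal →
              RingTheory.Sequence.IsWeaklyRegular (Y.presheaf.stalk y) (List.ofFn s)) →
        ∃ Z : Y.IdealSheafData, (Z.support : Set Y) ⊆ W ∧
          ∀ (Y' : Scheme.{0}) (π : Y' ⟶ Y), IsBlowup π Z →
            ∀ y' : Y', ∀ d : ℕ, ringKrullDim (Y'.presheaf.stalk y') = d →
              ∀ s : Fin d → Y'.presheaf.stalk y', (Ideal.span (Set.range s)).radical.IsMaximal →
                RingTheory.Sequence.IsWeaklyRegular (Y'.presheaf.stalk y') (List.ofFn s))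
    (hF : LocalFullificationFibreAdmGe4Split.LocalFInjectivizationFibreAdmGe4) :
    LocalFullificationFibreAdmGe4.LocalFullificationFibreAdmGe4 :=
  LocalFullificationFibreAdmGe4Split.localFullificationFibreAdmGe4_of_split (localMacaulayficationFibreAdmGe4_of_factOffClosed hM) hF

end Summit.ResolutionOfSingularities.ResolutionOfSingularities.Theorems.FInjectiveMacaulayfication.LocalMacaulayficationOfFactOffClosed

end
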